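import Summits.ResolutionOfSingularities.ResolutionOfSingularities.Theses.Valuative
import Summits.ResolutionOfSingularities.ResolutionOfSingularities.Theorems.PatchingRel.Negative.SandIntegralitySlack
import Literature.AlgebraicGeometry.Resolution.ProperModelsPatching
import Literature.AlgebraicGeometry.Resolution.PrincipalizationToResolution

/-!
# Negative-lane lemma for crux `PatchingRel` (stmt-ResolutionOfSingularities-0642), line
# `sandwiched-gluing`, stub `stub_sandwichedStrongResolution`: the CONCLUSION of the atom SAND⁺
# has no junk model

`SandwichedStrongResolution p` concludes `∃ (Y) (π : Y ⟶ V), IsResolution π ∧ …` with the weak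
`IsBirational` of `ResolutionOfSingularities.lean` (an isomorphism over SOME dense open with dense
preimage) and no integrality clause on `Y`. Junk-model probe (drefute gen 4): could a disconnected
or non-reduced `Y` — a copy of `V`'s regular part plus parasitic regular components, say — satisfy
the conclusion without being a resolution in the geometric sense? NO:

* `isIntegral_of_isResolution` — the source of ANY `IsResolution π` over an integral `V` is
  integral (regular ⇒ reduced, `Scheme.IsRegular.isReduced`; iso over a dense open with dense
  preimage ⇒ irreducible, `isIntegral_source_of_isBirational`);
* `sand_with_isIntegral_resolution` — hence SAND⁺ is EQUIVALENT to its variant demanding an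
  integral `Y` (the converse direction is trivial), i.e. the weak typing of the conclusion carries
  no slack a prover could exploit and no gap a user must fill.
-/

open CategoryTheory AlgebraicGeometry
open Literature.AlgebraicGeometry.Resolution

set_option linter.dupNamespace false

namespace Summit.ResolutionOfSingularities.ResolutionOfSingularities.Theorems.PatchingRel.Negative

universe u

/-- **The source of a resolution of an integral scheme is integral**: for `V` integral and
`π : Y → V` with `IsResolution π` (proper, weakly birational, `Y` regular), `Y` is integral.
[folklore] -/
theorem isIntegral_of_isResolution {Y V : Scheme.{u}} [IsIntegral V] (π : Y ⟶ V)
    (h : IsResolution π) : IsIntegral Y := by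
  haveI : IsReduced Y := h.isRegular.isReduced
  exact isIntegral_source_of_isBirational π h.isBirational

/-- **SAND⁺ with an integral resolving scheme**: `SandwichedStrongResolution p` implies its variant
whose conclusion additionally records `IsIntegral Y` (the converse is trivial), so the two typings
are equivalent. [folklore] -/
theorem sand_with_isIntegral_resolution (p : ℕ) (h : SandwichedStrongResolution.{u} p) :
    ∀ (k : Type u) [Field k] [CharP k p] (U V : Scheme.{u}) (f : U ⟶ Spec (.of k)) (η : V ⟶ U),
      IsSeparated f → LocallyOfFiniteType f → QuasiCompact f → IsIntegral U →
      Scheme.IsRegular U → IsIntegral V → IsProper η → IsBirational η →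
        ∃ (Y : Scheme.{u}) (π : Y ⟶ V), IsIntegral Y ∧ IsResolution π ∧
          ∃ W : V.Opens, (W : Set V) = Scheme.regularLocus V ∧ IsIso (π ∣_ W) := by
  intro k _ _ U V f η hsep hft hqc hU hreg hV hη hbir
  obtain ⟨Y, π, hres, W, hW, hiso⟩ := h k U V f η hsep hft hqc hU hreg hV hη hbir
  haveI := hV
  exact ⟨Y, π, isIntegral_of_isResolution π hres, hres, W, hW, hiso⟩

end Summit.ResolutionOfSingularities.ResolutionOfSingularities.Theorems.PatchingRel.Negative
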